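import Literature.MathematicalPhysics.QuantumFieldTheory.Balaban1983to89.B9Thm311DeltaAQIsUnitAtKnitRecordOfSections

/-!
# `Balaban1983to89.B9Thm311KnitRow17ThresholdsY` — T. Bałaban, *Propagators for lattice gauge theories in a background field*, Commun. Math. Phys. **99** (1985)
# 389–434 [Balaban1985BackgroundPropagators], THEOREM 3.11 p. 416 AT THE KNIT PAIR OF RECORD ON PRINT's CLASS (3.35): this seat's law-free member theorem
# `B9Thm311PosDefQknitAtKnitLetterLawFreeY.symm_posDefTr_deltaAQY_knitRecord_at_scMember` WITH ITS TWO EXISTENTIAL CONSTANTS NAMED (`knitRow17M₁`, `knitRow17a₁`) —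
# the closed terms a knit certificate's displayed numerics `knitRow17M₁ ≤ MInv`, `aInv ≤ knitRow17a₁` refer to (dag-n06-c's OFFER «named `choose`-thresholds»,
# 2026-08-31; the pattern of dag-n06-l's `B9Eq346GradGpDivAtPinsL2KnitClosed`)

statement-level skeleton of published theorems with citation tags; proofs where landed; nothing here is a claim about the Yang–Mills mass gap

THE PRINT.  Thm 3.11 p. 416 («the operators Δ′_a, G′, (Q′G′²Q′\*)⁻¹, Δ_a, G are positive definite»); Thm 3.3 p. 399; (3.26)–(3.27) p. 395; (3.19) p. 393 (the knit
transporters); (3.35) p. 396 (the cube class — print's «α₀ sufficiently small», «M sufficiently large» are the two thresholds named here); (3.115) p. 418;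
[5] = *Averaging operations …*, Commun. Math. Phys. **98** (1985), Prop. 2 (52)–(53) p. 26.

WHY THIS FILE (cell `pub-ymgap`, node N06, seat `dag-n06-j` gen 37 = bundle F5 row 17).  `symm_posDefTr_deltaAQY_knitRecord_at_scMember θ M⋆` reads
`∃ M₁ a₁ > 0, ∀ x, Surjective β → M₁ ≤ M → ∀ α₀ > 0, M·α₀ ≤ a₁ → ∀ U ∈ (bg9YP … x).Reg335 c₃₅ α₀, IsSymmTr … ∧ PosDefTr …`; a consumer that wants to DISPLAY the
smallness as x-free numerics on its own thresholds (`knitRow17M₁ ≤ MInv`, `aInv ≤ knitRow17a₁` — dag-n06-c's `…SectBStepUParKnitRecordNB.sectBStepUPar_knitRecordKCNBΔ`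
currently carries `∃ aΔ`) needs the two constants as closed terms.  THIS FILE names them by `Classical.choose` and restates the theorem, its `IsUnit` corollary, and the
J-indexed `hunitA` supplier of `B9Thm311DeltaAQIsUnitAtKnitRecordOfSections` at the named constants.

WHAT IS PROVED (2 `def` = names of existing existential constants; theorems sorry-free).
* `knitRow17M₁`, `knitRow17a₁` (defs), `knitRow17M₁_pos`, `knitRow17a₁_pos`;
* ★ `symm_posDefTr_deltaAQY_knitRecord_at_scMember_at` — the member theorem at the named thresholds; `isUnit_deltaAQY_knitRecord_at`;
* ★★ `hunitAQ_knitRecord_of_sections_at (hMInv : knitRow17M₁ ≤ MInv) (haInv : aInv ≤ knitRow17a₁)` — dag-n06-c's guarded `hunitA` along `(f, ιB, hι)` at any displayed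
  thresholds dominated by the named ones (class-keyed reading `bg9YC … extraYPb`).
HONEST SCOPE.  Naming and unpacking only; no estimate of [B9] asserted or re-proved; section-carrying members only; helper, count-neutral; N06 NOT discharged; nothing
continuum ∕ OS ∕ mass gap ∕ Clay — the Yang–Mills mass gap is NOT proved here.  No `sorry`, no `axiom`, no `instance`, no `notation`.  NEW file (definition lane).
RELATED, NOT DUPLICATED (searched 2026-08-31: `rg -l -w "KnitRow17Thresholds|knitRow17M₁|knitRow17a₁"` over `lean/{Literature,Summits,HarnessLib}` = ∅): n06-l
`B9Eq346GradGpDivAtPinsL2KnitClosed` (the pattern, for (3.46)₄), this seat's `B9Thm311PosDefQknitAtKnitLetterLawFreeY` ∕ `B9Thm311DeltaAQIsUnitAtKnitRecordOfSections` (the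
theorems whose constants are named — USED).
-/

noncomputable section

namespace Literature.MathematicalPhysics.QuantumFieldTheory.Balaban1983to89.B9Thm311KnitRow17ThresholdsY

open Literature.MathematicalPhysics.QuantumFieldTheory.Balaban1983to89
open Node00 B9Thm311ReadingCoords B6KLevelCensusIndexV1 B6Ineq2142KLevelV1 B6GlobalChartV1 B9PinMembersKLevelV1 B9PinGeometryKLevelV1 B9GeoNormsKLevelV1
  B9BackgroundsKLevelV1 B9BackgroundsKLevelV1P B7Prop2SpecialUnitary
open Literature.MathematicalPhysics.QuantumFieldTheory.Balaban1983to89.B9SectBCodedClassR (bg9YC extraYPb)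
open Literature.MathematicalPhysics.QuantumFieldTheory.Balaban1983to89.B9B8AveragingJunction (parKnitY)
open Literature.MathematicalPhysics.QuantumFieldTheory.Balaban1983to89.Node00.OpsYQLetter (qKnitOfRecord qsKnitOfRecord)
open Literature.MathematicalPhysics.QuantumFieldTheory.Balaban1983to89.B9Thm311PosDefQknitAtKnitLetterLawFreeY (symm_posDefTr_deltaAQY_knitRecord_at_scMember)
open scoped Matrix.Norms.L2Operator

variable (N : ℕ) [Nonempty (Fin N)] (θ : Stage3Params) (Mstar : ℕ)

/-- **THE THRESHOLD `M₁` OF ROW 17 AT THE KNIT RECORD, NAMED**: the first existential constant of `symm_posDefTr_deltaAQY_knitRecord_at_scMember θ M⋆` (print's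
«M sufficiently large», a function of the record `θ`, `M⋆` and `N`). [cite: Balaban1985BackgroundPropagators, Thm 3.11 p.416, (3.35) p.396] -/
def knitRow17M₁ : ℝ := (symm_posDefTr_deltaAQY_knitRecord_at_scMember (N := N) θ Mstar).choose

/-- **THE SMALLNESS THRESHOLD `a₁` (`M·α₀ ≤ a₁`) OF ROW 17 AT THE KNIT RECORD, NAMED**: the second existential constant of
`symm_posDefTr_deltaAQY_knitRecord_at_scMember θ M⋆` (print's «α₀ sufficiently small»). [cite: Balaban1985BackgroundPropagators, Thm 3.11 p.416, (3.35) p.396] -/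
def knitRow17a₁ : ℝ := (symm_posDefTr_deltaAQY_knitRecord_at_scMember (N := N) θ Mstar).choose_spec.choose

/-- The defining property of the two named constants (the member theorem, unpacked once). [cite: Balaban1985BackgroundPropagators, Thm 3.11 p.416, bookkeeping] -/
private theorem spec17 : 0 < knitRow17M₁ N θ Mstar ∧ 0 < knitRow17a₁ N θ Mstar ∧
    ∀ (x : MemberY θ.d₆ θ.ℓ₆ θ.hd' θ.hL' θ.b₀ θ.b₁ Mstar), Function.Surjective (β x.hN x.D x.hk) → knitRow17M₁ N θ Mstar ≤ (geo9Y x).M →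
      ∀ α₀ : ℝ, 0 < α₀ → (geo9Y x).M * α₀ ≤ knitRow17a₁ N θ Mstar →
      ∀ U : CfgY (Matrix (Fin N) (Fin N) ℂ) x.toKIdx,
        (bg9YP (Matrix (Fin N) (Fin N) ℂ) (specialUnitaryUnits (Fin N)) x).Reg335 c35Y α₀ U →
          IsSymmTr (fun _ => (1 : ℝ)) (deltaAQY x.toKIdx (qKnitOfRecord N θ x.toKIdx) (qsKnitOfRecord N θ x.toKIdx) (parKnitY x.toKIdx)
              (GpY x.toKIdx (parKnitY x.toKIdx)) U) ∧
            PosDefTr (fun _ => (1 : ℝ)) (deltaAQY x.toKIdx (qKnitOfRecord N θ x.toKIdx) (qsKnitOfRecord N θ x.toKIdx) (parKnitY x.toKIdx)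
              (GpY x.toKIdx (parKnitY x.toKIdx)) U) :=
  (symm_posDefTr_deltaAQY_knitRecord_at_scMember (N := N) θ Mstar).choose_spec.choose_spec

/-- `0 < knitRow17M₁`. [cite: Balaban1985BackgroundPropagators, Thm 3.11 p.416, bookkeeping] -/
theorem knitRow17M₁_pos : 0 < knitRow17M₁ N θ Mstar := (spec17 N θ Mstar).1

/-- `0 < knitRow17a₁`. [cite: Balaban1985BackgroundPropagators, Thm 3.11 p.416, bookkeeping] -/
theorem knitRow17a₁_pos : 0 < knitRow17a₁ N θ Mstar := (spec17 N θ Mstar).2.1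

/-- ★ **ROW 17 AT THE KNIT RECORD AT THE NAMED THRESHOLDS**: for every section-carrying member `x` with `knitRow17M₁ ≤ M`, every `α₀ > 0` with `M·α₀ ≤ knitRow17a₁`
and every `SU(N)`-valued `U ∈ (bg9YP … x).Reg335 c₃₅ α₀`, `Δ_a^𝔮(U)` at `(qKnitOfRecord, qsKnitOfRecord, parKnitY, GpY parKnitY)` is symmetric and positive definite
for the trace pairing. [cite: Balaban1985BackgroundPropagators, Thm 3.11 p.416 + Thm 3.3 p.399 + (3.26)–(3.27) p.395 + (3.19) p.393 + (3.35) p.396 + (3.115) p.418; Balaban1985Averaging, Prop. 2 (52)–(53) p.26] -/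
theorem symm_posDefTr_deltaAQY_knitRecord_at_scMember_at (x : MemberY θ.d₆ θ.ℓ₆ θ.hd' θ.hL' θ.b₀ θ.b₁ Mstar)
    (hsurj : Function.Surjective (β x.hN x.D x.hk)) (hM : knitRow17M₁ N θ Mstar ≤ (geo9Y x).M)
    (α₀ : ℝ) (hα : 0 < α₀) (ha : (geo9Y x).M * α₀ ≤ knitRow17a₁ N θ Mstar)
    (U : CfgY (Matrix (Fin N) (Fin N) ℂ) x.toKIdx) (hU : (bg9YP (Matrix (Fin N) (Fin N) ℂ) (specialUnitaryUnits (Fin N)) x).Reg335 c35Y α₀ U) :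
    IsSymmTr (fun _ => (1 : ℝ)) (deltaAQY x.toKIdx (qKnitOfRecord N θ x.toKIdx) (qsKnitOfRecord N θ x.toKIdx) (parKnitY x.toKIdx)
        (GpY x.toKIdx (parKnitY x.toKIdx)) U) ∧
      PosDefTr (fun _ => (1 : ℝ)) (deltaAQY x.toKIdx (qKnitOfRecord N θ x.toKIdx) (qsKnitOfRecord N θ x.toKIdx) (parKnitY x.toKIdx)
        (GpY x.toKIdx (parKnitY x.toKIdx)) U) :=
  (spec17 N θ Mstar).2.2 x hsurj hM α₀ hα ha U hU

/-- ★ **`Δ_a^𝔮(U)` AT THE KNIT PAIR IS A UNIT AT THE NAMED THRESHOLDS** (positive definite ⇒ unit). [cite: Balaban1985BackgroundPropagators, Thm 3.11 p.416 + (3.27) p.395 + (3.19) p.393 + (3.35) p.396] -/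
theorem isUnit_deltaAQY_knitRecord_at (x : MemberY θ.d₆ θ.ℓ₆ θ.hd' θ.hL' θ.b₀ θ.b₁ Mstar)
    (hsurj : Function.Surjective (β x.hN x.D x.hk)) (hM : knitRow17M₁ N θ Mstar ≤ (geo9Y x).M)
    (α₀ : ℝ) (hα : 0 < α₀) (ha : (geo9Y x).M * α₀ ≤ knitRow17a₁ N θ Mstar)
    (U : CfgY (Matrix (Fin N) (Fin N) ℂ) x.toKIdx) (hU : (bg9YP (Matrix (Fin N) (Fin N) ℂ) (specialUnitaryUnits (Fin N)) x).Reg335 c35Y α₀ U) :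
    IsUnit (deltaAQY x.toKIdx (qKnitOfRecord N θ x.toKIdx) (qsKnitOfRecord N θ x.toKIdx) (parKnitY x.toKIdx) (GpY x.toKIdx (parKnitY x.toKIdx)) U) :=
  isUnit_of_posDefTr (symm_posDefTr_deltaAQY_knitRecord_at_scMember_at N θ Mstar x hsurj hM α₀ hα ha U hU).2

/-- ★★ **dag-n06-c's GUARDED `hunitA` ALONG `(f, ιB, hι)` AT ANY DISPLAYED THRESHOLDS DOMINATED BY THE NAMED ONES**: for `knitRow17M₁ ≤ MInv` and
`aInv ≤ knitRow17a₁`, every sub-family `f` with sections `(ιB, hι)`, every `j`, `α₀`, `U`: `MInv ≤ M → 0 < α₀ → M·α₀ ≤ aInv →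
U ∈ (bg9YC 𝕄 SU(N) (extraYPb …) (f j)).Reg335 c₃₅ α₀ → IsUnit (deltaAQY (f j).toKIdx (qKnitOfRecord …) (qsKnitOfRecord …) (parKnitY …) (GpY … (parKnitY …)) U)` — the binder
of `B9Thm311DeltaAQIsUnitAtKnitRecordOfSections.hunitAQ_knitRecord_of_sections` with its `∃ MInv₀ aInv` replaced by the two x-free numerics.
[cite: Balaban1985BackgroundPropagators, Thm 3.11 p.416 + Thm 3.3 p.399 + (3.19) p.393 + (3.35) p.396; Balaban1985Averaging, Prop. 2 (52)–(53) p.26; Balaban1984PropagatorsII, (2.3) p.224 + (2.45) p.231] -/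
theorem hunitAQ_knitRecord_of_sections_at {MInv aInv : ℝ} (hMInv : knitRow17M₁ N θ Mstar ≤ MInv) (haInv : aInv ≤ knitRow17a₁ N θ Mstar)
    {J : Type} (f : J → MemberY θ.d₆ θ.ℓ₆ θ.hd' θ.hL' θ.b₀ θ.b₁ Mstar) (ιB : ∀ j : J, BlkY (f j).toKIdx → IBondY (f j).toKIdx)
    (hι : ∀ (j : J) (s : BlkY (f j).toKIdx), β (f j).toKIdx.hN (f j).toKIdx.D (f j).toKIdx.hk (ιB j s) = s)
    (j : J) (α₀ : ℝ) (U : CfgY (Matrix (Fin N) (Fin N) ℂ) (f j).toKIdx)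
    (hM : MInv ≤ (geo9Y (f j)).M) (hα : 0 < α₀) (ha : (geo9Y (f j)).M * α₀ ≤ aInv)
    (hU : (bg9YC (Matrix (Fin N) (Fin N) ℂ) (specialUnitaryUnits (Fin N))
      (extraYPb (Matrix (Fin N) (Fin N) ℂ) (specialUnitaryUnits (Fin N))) (f j)).Reg335 c35Y α₀ U) :
    IsUnit (deltaAQY (f j).toKIdx (qKnitOfRecord N θ (f j).toKIdx) (qsKnitOfRecord N θ (f j).toKIdx) (parKnitY (f j).toKIdx)
      (GpY (f j).toKIdx (parKnitY (f j).toKIdx)) U) :=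
  isUnit_deltaAQY_knitRecord_at N θ Mstar (f j) (fun s => ⟨ιB j s, hι j s⟩) (hMInv.trans hM) α₀ hα (ha.trans haInv) U ⟨⟨hU.1.1, hU.1.2.2⟩, hU.2⟩

end Literature.MathematicalPhysics.QuantumFieldTheory.Balaban1983to89.B9Thm311KnitRow17ThresholdsY

end
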